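import Literature.Probability.Process.BrownianSupTail
import Literature.Probability.RandomPlanarGeometry.BrownianOscillationTail
import Literature.MathematicalPhysics.KineticTheory.FouriersLaw
import HarnessLib

/-!
# `HiddenChargeMazur.StaticKubo`, line `birth`, stub `stub_brownianSupGaussTail` — sub-Gaussian tail of the running supremum of the Brownian pair

Helper file (`--supports stmt-AtomisticToContinuum-13510`, crux decl `HiddenChargeMazur.StaticKubo`,
registered stub `stub_brownianSupGaussTail` (S2) of the skeleton `Cruxes/StaticKubo/Lines/birth.lean`, rev 4).

For the pair of independent canonical Brownian motions (`wienerPair = preWiener ⊗ preWiener` on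
`WienerPair`) and the good event `goodEvent a h = {sup_{dyadic s ≤ h} |B¹_s| ≤ a, sup_{dyadic s ≤ h} |B²_s| ≤ a}`
(`Literature/Probability/Process/BrownianSupTail.lean`):

  `P((goodEvent a h)ᶜ) ≤ 4 · exp(-a²/(2h))`  for `a > 0`, `h > 0`,

i.e. the registered statement with `C = 4`, `c = 1/2`.

Proof: exactly the reduction of the tree's `O(h²)` bound `measure_compl_goodEvent_le`
(`(goodEvent a h)ᶜ ⊆ (A ×ˢ univ) ∪ (univ ×ˢ A)` with the one-dimensional bad event
`A = {ω₁ | ∃ s ≤ h, a ≤ |B_s ω₁|}`, and `Measure.prod_prod`), with the Doob tail replaced by the tree's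
Gaussian tail of the two-sided running maximum `measure_exists_le_abs_brownian_le_exp`
(`P(A) ≤ 2 exp(-a²/(2h))`, Doob's maximal inequality for the exponential martingale `exp(λB_t − λ²t/2)` at
`λ = ±a/h`; `Literature/Probability/RandomPlanarGeometry/BrownianOscillationTail.lean`).
[Revuz–Yor 1999, Ch. II Prop. (1.8); folklore]
-/

noncomputable section

open MeasureTheory Filter Topology
open scoped NNReal ENNReal
open Literature.MathematicalPhysics.KineticTheory.HeatConduction Literature.MathematicalPhysics.KineticTheory
open Literature.Probability.Process OscillatorChain

namespace Summit.AtomisticToContinuum.FouriersLaw.Cruxes.StaticKubo.Birth.Stubs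

/-- **One coordinate**: `P(∃ s ≤ h, a ≤ |B_s|) ≤ ofReal (2 exp(-(½ a²/h)))` for `a > 0` — the tree's Gaussian
tail of the two-sided running maximum, with the exponent rewritten. [Revuz–Yor 1999, Ch. II Prop. (1.8)] -/
theorem measure_exists_le_abs_brownian_le_exp_half (h : ℝ≥0) {a : ℝ} (ha : 0 < a) :
    preWienerMeasure {ω₁ | ∃ s ≤ h, a ≤ |brownian s ω₁|} ≤
      ENNReal.ofReal (2 * Real.exp (-(1 / 2 * a ^ 2 / h))) := by
  have hb := Literature.Probability.RandomPlanarGeometry.measure_exists_le_abs_brownian_le_exp h ha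
  have he : -a ^ 2 / (2 * (h : ℝ)) = -(1 / 2 * a ^ 2 / h) := by ring
  rwa [he] at hb

/-- **S2 — `stub_brownianSupGaussTail` (sub-Gaussian tail of the running supremum of the Brownian pair),
proved** with `C = 4`, `c = 1/2`: `P((goodEvent a h)ᶜ) ≤ 4 exp(-a²/(2h))` for `a, h > 0`. The complement of
the good event lies in `(A ×ˢ univ) ∪ (univ ×ˢ A)`, `A = {∃ s ≤ h, a ≤ |B_s|}` (as in
`measure_compl_goodEvent_le`), and `P(A) ≤ 2 exp(-a²/(2h))` (`measure_exists_le_abs_brownian_le_exp`, Doob's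
maximal inequality for the exponential martingale). [Revuz–Yor 1999, Ch. II Prop. (1.8); folklore] -/
theorem stub_brownianSupGaussTail :
    ∃ C c : ℝ, 0 < c ∧ ∀ (a : ℝ) (h : ℝ≥0), 0 < a → 0 < (h : ℝ) →
      wienerPair (goodEvent a h)ᶜ ≤ ENNReal.ofReal (C * Real.exp (-(c * a ^ 2 / h))) := by
  refine ⟨4, 1 / 2, by norm_num, fun a h ha _ => ?_⟩
  haveI := Literature.Probability.RandomPlanarGeometry.isProbabilityMeasure_preWienerMeasure'
  set A : Set (ℝ≥0 → ℝ) := {ω₁ | ∃ s ≤ h, a ≤ |brownian s ω₁|} with hA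
  have hsub : (goodEvent a h)ᶜ ⊆ (A ×ˢ Set.univ) ∪ (Set.univ ×ˢ A) := by
    intro ω hω
    simp only [goodEvent, Set.mem_compl_iff, Set.mem_setOf_eq, not_forall, not_and_or, not_le] at hω
    obtain ⟨n, m, hmn, hω⟩ := hω
    rcases hω with h1 | h2
    · exact Or.inl ⟨⟨_, hmn, h1.le⟩, Set.mem_univ _⟩
    · exact Or.inr ⟨Set.mem_univ _, ⟨_, hmn, h2.le⟩⟩
  have hb := measure_exists_le_abs_brownian_le_exp_half h ha
  have he0 : 0 ≤ 2 * Real.exp (-(1 / 2 * a ^ 2 / h)) := by positivity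
  calc wienerPair (goodEvent a h)ᶜ ≤ wienerPair ((A ×ˢ Set.univ) ∪ (Set.univ ×ˢ A)) := measure_mono hsub
    _ ≤ wienerPair (A ×ˢ Set.univ) + wienerPair (Set.univ ×ˢ A) := measure_union_le _ _
    _ = preWienerMeasure A + preWienerMeasure A := by
        rw [wienerPair, Measure.prod_prod, Measure.prod_prod, measure_univ, mul_one, one_mul]
    _ ≤ ENNReal.ofReal (2 * Real.exp (-(1 / 2 * a ^ 2 / h))) +
          ENNReal.ofReal (2 * Real.exp (-(1 / 2 * a ^ 2 / h))) := add_le_add hb hb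
    _ = ENNReal.ofReal (4 * Real.exp (-(1 / 2 * a ^ 2 / h))) := by
        rw [← ENNReal.ofReal_add he0 he0]
        congr 1
        ring

end Summit.AtomisticToContinuum.FouriersLaw.Cruxes.StaticKubo.Birth.Stubs

end
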